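import Literature.MathematicalPhysics.QuantumLattice.FermionOperators
import Literature.MathematicalPhysics.QuantumLattice.HubbardWave0Proofs
import HarnessLib

/-!
# Discharges for the fermionic Fock-space operators: CAR, vacuum, and Yang's `η`-algebra

Trunk T-QLATTICE, family `hubbard`. Sibling proof file of
`Literature/MathematicalPhysics/QuantumLattice/FermionOperators.lean` (and of the wave-0 glue
`HubbardWave0.lean` it re-exports): everything here is PROVED from the concrete Jordan–Wigner
matrices of wave 0 (`annihilation i s t = [i ∉ s ∧ t = insert i s] · (-1)^{#{j ∈ s | j < i}}`,
`creation i = (annihilation i)ᴴ`, `vacuum = |∅⟩`); no statement is introduced or changed.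

Proved here (namespace `Literature.Hubbard` for the orbital-generic part, `Literature.QLattice` for the Hubbard
orbitals `Orb Λ = Λ ×ₗ Fin 2`):

* basis actions `annihilation_mulVec_single`, `creation_mulVec_single`
  (`c_i |s⟩ = [i ∈ s] σ_i(s) |s ∖ i⟩`, `c†_i |s⟩ = [i ∉ s] σ_i(s) |s ∪ i⟩`) and the extensionality
  principle `ext_of_mulVec_single`;
* the discharges `annihilation_anticommute_holds` (`{c_i, c_j} = 0`),
  `annihilation_mul_creation_add_creation_mul_annihilation_holds` (`{c_i, c†_j} = δ_ij`) of the
  wave-0 named facts (the third one, `annihilation_mulVec_vacuum_holds`, `c_i |0⟩ = 0`, is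
  imported from `HubbardWave0Proofs`), and `creation_anticommute_holds` (`{c†_i, c†_j} = 0`),
  `totalNumber_commutator_etaRaise_holds` (`[N, η†] = 2η†`) of the `FermionOperators` facts;
* the grading discharge `IsNParticle.creation_mulVec_holds` (`c†_i` maps the `N`-particle
  sector into the `(N+1)`-particle sector) of the `FermionOperators` fact
  `Literature.MathematicalPhysics.QuantumLattice.IsNParticle.creation_mulVec`, and (appended at the end of the file) the companion
  discharge `IsNParticle.annihilation_mulVec_holds` (`c_i` maps the `(N+1)`-particle sector into
  the `N`-particle sector) of `Literature.MathematicalPhysics.QuantumLattice.IsNParticle.annihilation_mulVec`;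
* the bilinear commutator `hop_pair_commutator`
  (`[c†_a c_b, c†_p c†_q] = δ_bp c†_a c†_q - δ_bq c†_a c†_p`) and its consequences for Yang's
  `η† = Σ_z ε_z c†_{z↑} c†_{z↓}`: `hopping_commute_etaRaise` (the hopping term of the Hubbard
  Hamiltonian on ANY graph commutes with `η†` as soon as `ε_x = -ε_y` on every edge),
  `interaction_commutator_etaRaise` (`[Σ_x n_{x↑} n_{x↓}, η†] = η†`), whence
  `hamiltonian_commutator_etaRaise` (`[H(t,U), η†] = U η†`, Yang's eq. (6)) and
  `hamiltonian_mulVec_vacuum` (`H |0⟩ = 0`);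
* the explicit form of the `η`-tower on the vacuum, `etaRaise_pow_mulVec_vacuum`:
  `(η†)^m |0⟩ = m! Σ_{S ⊆ Λ, #S = m} (∏_{x ∈ S} ε_x) |S × {↑,↓}⟩` (pair creators act on fully
  paired basis states without Jordan–Wigner sign, `pairCreation_mulVec_single_pairs`, and the
  double count `sum_powersetCard_sum_insert`), and its non-vanishing for `m ≤ |Λ|`,
  `etaRaise_pow_mulVec_vacuum_ne_zero`.

The paired orbital sets are handled through an arbitrary `P : Finset Λ → Finset (Orb Λ)` with
`i ∈ P S ↔ (ofLex i).1 ∈ S` (e.g. `P S = (S ×ˢ univ).map toLex`), so that no definition is needed.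

## Sources

F. H. L. Essler, H. Frahm, F. Göhmann, A. Klümper, V. E. Korepin, *The One-Dimensional Hubbard
Model* (CUP 2005), §2.1 eqs. (2.2)–(2.3), (2.8) (CAR, vacuum, `[n, c†]`), §2.2 eq. (2.72)
(commutators of fermion bilinears), §2.2.5 eqs. (2.80)–(2.87) (`η`-pairing operators,
`[N, η^±] = ±2η^±`, invariance "only for an even number of lattice sites", i.e. bipartiteness);
C. N. Yang, *η pairing and off-diagonal long-range order in a Hubbard model*, PRL **63** (1989)
2144, eqs. (4)–(8); O. Bratteli, D. W. Robinson, *Operator Algebras and QSM II*, §5.2.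
-/

namespace Literature.MathematicalPhysics.QuantumLattice

open Matrix Finset

variable {ι : Type*} [LinearOrder ι]

/-! ### Jordan–Wigner matrices: entries, signs, basis action -/

/-- The matrix entry of `c_i`: `⟨s| c_i |t⟩ = σ_i(s)` if `t = insert i s` with `i ∉ s`, else `0`
(definitional). Essler et al. (2005) §2.1. [folklore] -/
theorem annihilation_apply (i : ι) (s t : Finset ι) :
    annihilation i s t = if i ∉ s ∧ t = insert i s then jwSign i s else 0 := rfl

/-- The Jordan–Wigner sign is real: `star σ_i(s) = σ_i(s)`. [folklore] -/
theorem star_jwSign (i : ι) (s : Finset ι) : star (jwSign i s) = jwSign i s := by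
  simp [jwSign]

/-- The matrix entry of `c†_i = (c_i)ᴴ`: `⟨t| c†_i |s⟩ = σ_i(s)` if `t = insert i s` with `i ∉ s`,
else `0`. Essler et al. (2005) §2.1. [folklore] -/
theorem creation_apply (i : ι) (t s : Finset ι) :
    creation i t s = if i ∉ s ∧ t = insert i s then jwSign i s else 0 := by
  rw [creation, conjTranspose_apply, annihilation_apply]
  split_ifs <;> simp [star_jwSign]

/-- `σ_i(s)² = 1`. [folklore] -/
theorem jwSign_mul_self (i : ι) (s : Finset ι) : jwSign i s * jwSign i s = 1 := by
  rw [jwSign, ← pow_add, ← two_mul, pow_mul]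
  norm_num

/-- `σ_i(s) ≠ 0`. [folklore] -/
theorem jwSign_ne_zero (i : ι) (s : Finset ι) : jwSign i s ≠ 0 :=
  pow_ne_zero _ (by norm_num)

/-- Inserting an orbital `j < i` below `i` flips the Jordan–Wigner sign at `i`. [folklore] -/
theorem jwSign_insert_of_lt {i j : ι} {s : Finset ι} (hj : j ∉ s) (h : j < i) :
    jwSign i (insert j s) = -jwSign i s := by
  rw [jwSign, filter_insert, if_pos h,
    card_insert_of_notMem (fun h' => hj (mem_of_mem_filter _ h')), pow_succ, jwSign, mul_neg_one]

/-- Inserting an orbital `j` not below `i` does not change the Jordan–Wigner sign at `i`.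
[folklore] -/
theorem jwSign_insert_of_not_lt {i j : ι} {s : Finset ι} (h : ¬j < i) :
    jwSign i (insert j s) = jwSign i s := by
  rw [jwSign, filter_insert, if_neg h, jwSign]

/-- Erasing an orbital `j` not below `i` does not change the Jordan–Wigner sign at `i`.
[folklore] -/
theorem jwSign_erase_of_not_lt {i j : ι} {s : Finset ι} (h : ¬j < i) :
    jwSign i (s.erase j) = jwSign i s := by
  rw [jwSign, jwSign, filter_erase, erase_eq_of_notMem]
  exact fun h' => h (mem_filter.1 h').2

/-- Erasing an occupied orbital `j < i` flips the Jordan–Wigner sign at `i`. [folklore] -/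
theorem jwSign_erase_of_lt {i j : ι} {s : Finset ι} (hj : j ∈ s) (h : j < i) :
    jwSign i (s.erase j) = -jwSign i s := by
  have := jwSign_insert_of_lt (s := s.erase j) (notMem_erase j s) h
  rw [insert_erase hj] at this
  rw [this, neg_neg]

variable [Fintype ι]

/-- Action of `c_i` on an occupation basis vector: `c_i |s⟩ = σ_i(s) |s ∖ {i}⟩` if `i ∈ s`, and
`0` otherwise. Essler et al. (2005) §2.1, eqs. (2.2)–(2.4). [folklore] -/
theorem annihilation_mulVec_single (i : ι) (s : Finset ι) :
    annihilation i *ᵥ Pi.single s (1 : ℂ) =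
      if i ∈ s then jwSign i s • Pi.single (s.erase i) 1 else 0 := by
  ext t
  rw [mulVec_single_one, col_apply, annihilation_apply]
  by_cases hi : i ∈ s
  · rw [if_pos hi, Pi.smul_apply, smul_eq_mul]
    by_cases ht : t = s.erase i
    · subst ht
      rw [if_pos ⟨notMem_erase i s, (insert_erase hi).symm⟩, jwSign_erase_of_not_lt (lt_irrefl i)]
      simp
    · rw [if_neg, Pi.single_eq_of_ne ht, mul_zero]
      rintro ⟨hit, rfl⟩
      exact ht (erase_insert hit).symm
  · rw [if_neg hi, if_neg, Pi.zero_apply]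
    rintro ⟨-, rfl⟩
    exact hi (mem_insert_self i t)

/-- Action of `c†_i` on an occupation basis vector: `c†_i |s⟩ = σ_i(s) |s ∪ {i}⟩` if `i ∉ s`, and
`0` otherwise (Pauli principle). Essler et al. (2005) §2.1, eqs. (2.2)–(2.4). [folklore] -/
theorem FermionOperatorsProofs.creation_mulVec_single (i : ι) (s : Finset ι) :
    creation i *ᵥ Pi.single s (1 : ℂ) =
      if i ∈ s then 0 else jwSign i s • Pi.single (insert i s) 1 := by
  ext t
  rw [mulVec_single_one, col_apply, creation_apply]
  by_cases hi : i ∈ s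
  · rw [if_pos hi, if_neg (fun h => h.1 hi), Pi.zero_apply]
  · rw [if_neg hi, Pi.smul_apply, smul_eq_mul]
    by_cases ht : t = insert i s
    · subst ht
      simp [hi]
    · rw [if_neg (fun h => ht h.2), Pi.single_eq_of_ne ht, mul_zero]

/-- Two Fock-space operators that agree on every occupation basis vector are equal. [folklore] -/
theorem ext_of_mulVec_single {A B : Matrix (Finset ι) (Finset ι) ℂ}
    (h : ∀ s : Finset ι, A *ᵥ Pi.single s 1 = B *ᵥ Pi.single s 1) : A = B := by
  ext t s
  have := congrFun (h s) t
  rwa [mulVec_single_one, mulVec_single_one, col_apply, col_apply] at this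

/-! ### The canonical anticommutation relations (discharges of the wave-0 named facts) -/

/-- **Discharge of `annihilation_anticommute`** (pure CAR): `c_i c_j + c_j c_i = 0` for the
Jordan–Wigner matrices (checked on basis vectors; the two orders of removing `i` and `j` carry
opposite signs). Essler et al. (2005) §2.1, eq. (2.2a); Bratteli–Robinson II §5.2.
[cite: EsslerEtAl2005, §2.1 eq. (2.2a)] -/
theorem annihilation_anticommute_holds : annihilation_anticommute (ι := ι) := by
  intro i j
  refine ext_of_mulVec_single fun s => ?_
  rw [add_mulVec, ← mulVec_mulVec, ← mulVec_mulVec, zero_mulVec, annihilation_mulVec_single j s,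
    annihilation_mulVec_single i s]
  rcases lt_trichotomy i j with hij | rfl | hji
  · -- i < j
    by_cases hi : i ∈ s <;> by_cases hj : j ∈ s
    · rw [if_pos hj, if_pos hi, mulVec_smul, mulVec_smul, annihilation_mulVec_single,
        annihilation_mulVec_single, if_pos (mem_erase.2 ⟨hij.ne, hi⟩),
        if_pos (mem_erase.2 ⟨hij.ne', hj⟩), jwSign_erase_of_not_lt (not_lt.2 hij.le),
        jwSign_erase_of_lt hi hij, erase_right_comm, smul_smul, smul_smul]
      rw [← add_smul]; ring_nf; simp
    · rw [if_neg hj, if_pos hi, mulVec_zero, mulVec_smul, annihilation_mulVec_single,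
        if_neg (fun h => hj (mem_of_mem_erase h)), smul_zero, add_zero]
    · rw [if_pos hj, if_neg hi, mulVec_zero, mulVec_smul, annihilation_mulVec_single,
        if_neg (fun h => hi (mem_of_mem_erase h)), smul_zero, zero_add]
    · rw [if_neg hi, if_neg hj, mulVec_zero, mulVec_zero, add_zero]
  · -- i = j
    by_cases hi : i ∈ s
    · rw [if_pos hi, mulVec_smul, annihilation_mulVec_single, if_neg (notMem_erase i s), smul_zero,
        add_zero]
    · rw [if_neg hi, mulVec_zero, add_zero]
  · -- j < i
    by_cases hi : i ∈ s <;> by_cases hj : j ∈ s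
    · rw [if_pos hj, if_pos hi, mulVec_smul, mulVec_smul, annihilation_mulVec_single,
        annihilation_mulVec_single, if_pos (mem_erase.2 ⟨hji.ne', hi⟩),
        if_pos (mem_erase.2 ⟨hji.ne, hj⟩), jwSign_erase_of_lt hj hji,
        jwSign_erase_of_not_lt (not_lt.2 hji.le), erase_right_comm, smul_smul, smul_smul]
      rw [← add_smul]; ring_nf; simp
    · rw [if_neg hj, if_pos hi, mulVec_zero, mulVec_smul, annihilation_mulVec_single,
        if_neg (fun h => hj (mem_of_mem_erase h)), smul_zero, add_zero]
    · rw [if_pos hj, if_neg hi, mulVec_zero, mulVec_smul, annihilation_mulVec_single,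
        if_neg (fun h => hi (mem_of_mem_erase h)), smul_zero, zero_add]
    · rw [if_neg hi, if_neg hj, mulVec_zero, mulVec_zero, add_zero]

/-- **Discharge of `annihilation_mul_creation_add_creation_mul_annihilation`** (mixed CAR):
`c_i c†_j + c†_j c_i = δ_ij` for the Jordan–Wigner matrices. Essler et al. (2005) §2.1,
eq. (2.2b); Bratteli–Robinson II §5.2. [cite: EsslerEtAl2005, §2.1 eq. (2.2b)] -/
theorem annihilation_mul_creation_add_creation_mul_annihilation_holds :
    annihilation_mul_creation_add_creation_mul_annihilation (ι := ι) := by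
  intro i j
  refine ext_of_mulVec_single fun s => ?_
  rw [add_mulVec, ← mulVec_mulVec, ← mulVec_mulVec, FermionOperatorsProofs.creation_mulVec_single j s,
    annihilation_mulVec_single i s]
  rcases lt_trichotomy i j with hij | rfl | hji
  · -- i < j
    rw [if_neg hij.ne, zero_mulVec]
    by_cases hi : i ∈ s <;> by_cases hj : j ∈ s
    · rw [if_pos hj, if_pos hi, mulVec_zero, zero_add, mulVec_smul, FermionOperatorsProofs.creation_mulVec_single,
        if_pos (mem_erase.2 ⟨hij.ne', hj⟩), smul_zero]
    · rw [if_neg hj, if_pos hi, mulVec_smul, mulVec_smul, annihilation_mulVec_single,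
        FermionOperatorsProofs.creation_mulVec_single, if_pos (mem_insert_of_mem hi),
        if_neg (fun h => hj (mem_of_mem_erase h)), jwSign_insert_of_not_lt (not_lt.2 hij.le),
        jwSign_erase_of_lt hi hij, ← erase_insert_of_ne hij.ne', smul_smul, smul_smul, ← add_smul]
      ring_nf; simp
    · rw [if_pos hj, if_neg hi, mulVec_zero, mulVec_zero, add_zero]
    · rw [if_neg hj, if_neg hi, mulVec_zero, add_zero, mulVec_smul, annihilation_mulVec_single,
        if_neg (by simp [hi, hij.ne]), smul_zero]
  · -- i = j
    rw [if_pos rfl, one_mulVec]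
    by_cases hi : i ∈ s
    · rw [if_pos hi, if_pos hi, mulVec_zero, zero_add, mulVec_smul, FermionOperatorsProofs.creation_mulVec_single,
        if_neg (notMem_erase i s), insert_erase hi, jwSign_erase_of_not_lt (lt_irrefl i), smul_smul,
        jwSign_mul_self, one_smul]
    · rw [if_neg hi, if_neg hi, mulVec_zero, add_zero, mulVec_smul, annihilation_mulVec_single,
        if_pos (mem_insert_self i s), erase_insert hi, jwSign_insert_of_not_lt (lt_irrefl i),
        smul_smul, jwSign_mul_self, one_smul]
  · -- j < i
    rw [if_neg hji.ne', zero_mulVec]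
    by_cases hi : i ∈ s <;> by_cases hj : j ∈ s
    · rw [if_pos hj, if_pos hi, mulVec_zero, zero_add, mulVec_smul, FermionOperatorsProofs.creation_mulVec_single,
        if_pos (mem_erase.2 ⟨hji.ne, hj⟩), smul_zero]
    · rw [if_neg hj, if_pos hi, mulVec_smul, mulVec_smul, annihilation_mulVec_single,
        FermionOperatorsProofs.creation_mulVec_single, if_pos (mem_insert_of_mem hi),
        if_neg (fun h => hj (mem_of_mem_erase h)), jwSign_insert_of_lt hj hji,
        jwSign_erase_of_not_lt (not_lt.2 hji.le), ← erase_insert_of_ne hji.ne, smul_smul, smul_smul,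
        ← add_smul]
      ring_nf; simp
    · rw [if_pos hj, if_neg hi, mulVec_zero, mulVec_zero, add_zero]
    · rw [if_neg hj, if_neg hi, mulVec_zero, add_zero, mulVec_smul, annihilation_mulVec_single,
        if_neg (by simp [hi, hji.ne']), smul_zero]

/-! ### Grading: `c†_i` raises the particle number by one -/

/-- **Discharge of `Literature.MathematicalPhysics.QuantumLattice.IsNParticle.creation_mulVec`**: `c†_i` maps the `N`-particle
sector into the `(N+1)`-particle sector. In the occupation basis
`(c†_i ψ)(s) = Σ_t conj (⟨t| c_i |s⟩) ψ(t)`, and `⟨t| c_i |s⟩ ≠ 0` forces `s = insert i t` with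
`i ∉ t`, i.e. `#s = #t + 1`; for an `N`-particle `ψ` only `#t = N` contributes, so `c†_i ψ` is
supported on `#s = N + 1`. This is the grading `a*(f) 𝔥ⁿ ⊆ 𝔥ⁿ⁺¹` of the creation operator on
the antisymmetric Fock space, Bratteli–Robinson II §5.2.1–§5.2.2; see also Glimm–Jaffe,
*Quantum Physics* (2nd ed.) §6.5, eq. (6.5.3), p. 114 (`a*(g)` takes `𝓕_n` to `𝓕_{n+1}`).
[cite: BratteliRobinsonII1997, §5.2.2] -/
theorem IsNParticle.creation_mulVec_holds : IsNParticle.creation_mulVec (ι := ι) := by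
  intro N ψ hψ i s hs
  simp only [mulVec, dotProduct, creation, conjTranspose_apply, annihilation]
  refine sum_eq_zero fun t _ => ?_
  split_ifs with h
  · have ht : t.card ≠ N := fun htN => hs (by rw [h.2, card_insert_of_notMem h.1, htN])
    rw [hψ t ht, mul_zero]
  · rw [star_zero, zero_mul]

/-! ### Algebraic consequences of the CAR -/

/-- Pure CAR for creation operators, pointwise: `c†_i c†_j + c†_j c†_i = 0` (adjoint of
`annihilation_anticommute_holds`). Essler et al. (2005) §2.1, eq. (2.2a).
[cite: EsslerEtAl2005, §2.1 eq. (2.2a)] -/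
theorem creation_anticomm (i j : ι) :
    creation i * creation j + creation j * creation i = 0 := by
  have h := congrArg conjTranspose (annihilation_anticommute_holds (ι := ι) j i)
  rwa [conjTranspose_add, conjTranspose_mul, conjTranspose_mul, Literature.MathematicalPhysics.QuantumLattice.annihilation_conjTranspose,
    Literature.MathematicalPhysics.QuantumLattice.annihilation_conjTranspose, conjTranspose_zero] at h

/-- `c†_i c†_j = -c†_j c†_i`. Essler et al. (2005) §2.1, eq. (2.2a). [folklore] -/
theorem creation_mul_creation_eq_neg (i j : ι) :
    creation i * creation j = -(creation j * creation i) :=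
  eq_neg_of_add_eq_zero_left (creation_anticomm i j)

/-- Pauli principle: `(c†_i)² = 0`. Essler et al. (2005) §2.1 ("`(c†_{j,a})² = 0`"). [folklore] -/
theorem creation_mul_self (i : ι) : creation i * creation i = 0 := by
  have h : (2 : ℂ) • (creation i * creation i) = 0 := by
    rw [two_smul]; exact creation_anticomm i i
  exact (smul_eq_zero.1 h).resolve_left two_ne_zero

/-- Normal ordering: `c_i c†_j = δ_ij - c†_j c_i`. Essler et al. (2005) §2.1, eq. (2.2b).
[folklore] -/
theorem annihilation_mul_creation (i j : ι) :
    annihilation i * creation j = (if i = j then 1 else 0) - creation j * annihilation i :=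
  eq_sub_of_add_eq (annihilation_mul_creation_add_creation_mul_annihilation_holds i j)

/-- `n_a` commutes with `c†_p` for `p ≠ a` (`[n_{i,a}, c†_{k,b}] = δδ c†`, off-diagonal part).
Essler et al. (2005) §2.1, eq. (2.8). [folklore] -/
theorem number_mul_creation_of_ne {a p : ι} (h : a ≠ p) :
    creation a * annihilation a * creation p = creation p * (creation a * annihilation a) := by
  rw [mul_assoc, annihilation_mul_creation, if_neg h, zero_sub, mul_neg, ← mul_assoc,
    creation_mul_creation_eq_neg a p, neg_mul, neg_neg, mul_assoc]

/-- `n_a c†_a = c†_a` (after creating `a`, the orbital is occupied). Essler et al. (2005) §2.1,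
eq. (2.8). [folklore] -/
theorem number_mul_creation_self (a : ι) :
    creation a * annihilation a * creation a = creation a := by
  rw [mul_assoc, annihilation_mul_creation, if_pos rfl, mul_sub, mul_one, ← mul_assoc,
    creation_mul_self, zero_mul, sub_zero]

/-- `c†_a n_a = 0` (one cannot create into an occupied orbital). Essler et al. (2005) §2.1,
eq. (2.8). [folklore] -/
theorem creation_mul_number_self (a : ι) :
    creation a * (creation a * annihilation a) = 0 := by
  rw [← mul_assoc, creation_mul_self, zero_mul]

/-- Commutator of a hopping bilinear with a pair creator:
`[c†_a c_b, c†_p c†_q] = δ_bp c†_a c†_q - δ_bq c†_a c†_p`. (The `gl`-type commutator of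
fermion bilinears, Essler et al. (2005) §2.2, eq. (2.72), in the form needed for `η†`.)
[cite: EsslerEtAl2005, §2.2 eq. (2.72)] -/
theorem hop_pair_commutator (a b p q : ι) :
    creation a * annihilation b * (creation p * creation q) -
        creation p * creation q * (creation a * annihilation b) =
      (if b = p then creation a * creation q else 0) -
        (if b = q then creation a * creation p else 0) := by
  have h3 : creation a * creation p * creation q = creation p * creation q * creation a := by
    rw [creation_mul_creation_eq_neg a p, neg_mul, mul_assoc, creation_mul_creation_eq_neg a q,
      mul_neg, neg_neg, mul_assoc]
  calc creation a * annihilation b * (creation p * creation q) -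
        creation p * creation q * (creation a * annihilation b)
      = creation a * (annihilation b * creation p) * creation q -
          creation p * creation q * (creation a * annihilation b) := by
        simp only [mul_assoc]
    _ = creation a * ((if b = p then 1 else 0) - creation p * annihilation b) * creation q -
          creation p * creation q * (creation a * annihilation b) := by
        rw [annihilation_mul_creation]
    _ = (if b = p then creation a * creation q else 0) -
          creation a * creation p * (annihilation b * creation q) -
          creation p * creation q * (creation a * annihilation b) := by
        split_ifs <;> noncomm_ring
    _ = (if b = p then creation a * creation q else 0) -
          creation a * creation p * ((if b = q then 1 else 0) - creation q * annihilation b) -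
          creation p * creation q * (creation a * annihilation b) := by
        rw [annihilation_mul_creation b q]
    _ = (if b = p then creation a * creation q else 0) -
          (if b = q then creation a * creation p else 0) +
          (creation a * creation p * creation q * annihilation b -
            creation p * creation q * (creation a * annihilation b)) := by
        split_ifs <;> noncomm_ring
    _ = _ := by rw [h3]; noncomm_ring

/-- Commutator of a number operator with a pair creator:
`[n_a, c†_p c†_q] = (δ_ap + δ_aq) c†_p c†_q`. Essler et al. (2005) §2.1, eq. (2.8).
[folklore] -/
theorem number_pair_commutator (a p q : ι) :
    creation a * annihilation a * (creation p * creation q) -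
        creation p * creation q * (creation a * annihilation a) =
      (if a = p then creation p * creation q else 0) +
        (if a = q then creation p * creation q else 0) := by
  rw [hop_pair_commutator]
  by_cases hp : a = p <;> by_cases hq : a = q
  · subst hp; subst hq
    simp [creation_mul_self]
  · subst hp
    simp [hq]
  · subst hq
    simp [hp, creation_mul_creation_eq_neg a p]
  · simp [hp, hq]

end Literature.MathematicalPhysics.QuantumLattice

namespace Literature.MathematicalPhysics.QuantumLattice

open Matrix Finset FermionOperatorsProofs

variable {ι : Type*} [LinearOrder ι] [Fintype ι]

/-- **Discharge of `creation_anticommute`**: `c†_i c†_j + c†_j c†_i = 0`.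
Bratteli–Robinson II §5.2.2 (5.2.11); Essler et al. (2005) §2.1, eq. (2.2a).
[cite: EsslerEtAl2005, §2.1 eq. (2.2a)] -/
theorem creation_anticommute_holds : creation_anticommute (ι := ι) :=
  fun i j => creation_anticomm i j

section Hubbard

variable {Λ : Type*} [LinearOrder Λ] [Fintype Λ]

omit [LinearOrder Λ] [Fintype Λ] in
/-- Two Hubbard orbitals `(x, σ)`, `(y, τ)` coincide iff `x = y` and `σ = τ`. [folklore] -/
theorem orb_eq_orb_iff {x y : Λ} {σ τ : Fin 2} : orb x σ = orb y τ ↔ x = y ∧ σ = τ := by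
  simp [Prod.ext_iff]

/-! ### Commutators with Yang's `η†` -/

/-- The commutator of any operator with `η† = Σ_z ε_z c†_{z↑} c†_{z↓}`, term by term.
Yang, PRL 63 (1989) 2144, eq. (4). [folklore] -/
theorem commutator_etaRaise (ε : Λ → ℤˣ) (A : Matrix (Finset (Orb Λ)) (Finset (Orb Λ)) ℂ) :
    A * etaRaise ε - etaRaise ε * A =
      ∑ z, ((ε z : ℤ) : ℂ) • (A * (creation (orb z 0) * creation (orb z 1)) -
        creation (orb z 0) * creation (orb z 1) * A) := by
  simp only [etaRaise, mul_sum, sum_mul, mul_smul_comm, smul_mul_assoc, smul_sub, sum_sub_distrib]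

/-- Commutator of one hopping term with `η†`:
`[c†_{xσ} c_{yσ}, η†] = ε_y c†_{x↑} c†_{y↓}` for `σ = ↑` and `= -ε_y c†_{x↓} c†_{y↑}` for `σ = ↓`.
Essler et al. (2005) §2.2.5 (via eq. (2.72)); Yang, PRL 63 (1989) 2144, eq. (6). [folklore] -/
theorem hopTerm_commutator_etaRaise (ε : Λ → ℤˣ) (x y : Λ) (σ : Fin 2) :
    creation (orb x σ) * annihilation (orb y σ) * etaRaise ε -
        etaRaise ε * (creation (orb x σ) * annihilation (orb y σ)) =
      ((ε y : ℤ) : ℂ) • (if σ = 0 then creation (orb x 0) * creation (orb y 1)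
        else -(creation (orb x 1) * creation (orb y 0))) := by
  rw [commutator_etaRaise]
  simp only [hop_pair_commutator]
  rw [Finset.sum_eq_single y]
  · fin_cases σ
    · simp
    · simp
  · intro z _ hz
    rw [if_neg (fun h => hz (orb_eq_orb_iff.1 h).1.symm),
      if_neg (fun h => hz (orb_eq_orb_iff.1 h).1.symm), sub_zero, smul_zero]
  · exact fun h => absurd (mem_univ y) h

/-- **The hopping term commutes with `η†` on a bipartite graph.** For any finite graph `G` and
any sign `ε` with `ε_x = -ε_y` on every edge, the Hubbard hopping operator
`Σ_{x ∼ y} Σ_σ c†_{xσ} c_{yσ}` commutes with `η†_ε`: summing `hopTerm_commutator_etaRaise` over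
`σ` gives `ε_y K(x,y)` with `K(x,y) = c†_{x↑} c†_{y↓} - c†_{x↓} c†_{y↑}` symmetric in `x, y`, so
the sum `S` over ordered edges satisfies `S = -S`. This is the kinetic part of Yang's commutator
computation, PRL 63 (1989) 2144, eq. (6); Essler et al. (2005) §2.2.5, eq. (2.84) and the remark
that the `η`-symmetry "holds only for an even number of lattice sites". [cite: Yang1989, eq. (6)] -/
theorem hopping_commute_etaRaise (G : SimpleGraph Λ) [DecidableRel G.Adj] (ε : Λ → ℤˣ)
    (hε : ∀ x y, G.Adj x y → ε x = -ε y) :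
    (∑ x, ∑ y, ∑ σ : Fin 2,
        if G.Adj x y then creation (orb x σ) * annihilation (orb y σ) else 0) * etaRaise ε =
      etaRaise ε * ∑ x, ∑ y, ∑ σ : Fin 2,
        if G.Adj x y then creation (orb x σ) * annihilation (orb y σ) else 0 := by
  set K : Λ → Λ → Matrix (Finset (Orb Λ)) (Finset (Orb Λ)) ℂ := fun x y =>
    creation (orb x 0) * creation (orb y 1) - creation (orb x 1) * creation (orb y 0) with hK
  have hKsymm : ∀ x y, K y x = K x y := by
    intro x y
    simp only [hK]
    rw [creation_mul_creation_eq_neg (orb y 0) (orb x 1),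
      creation_mul_creation_eq_neg (orb y 1) (orb x 0)]
    abel
  have hterm : ∀ x y (σ : Fin 2),
      (if G.Adj x y then creation (orb x σ) * annihilation (orb y σ) else 0) * etaRaise ε -
        etaRaise ε * (if G.Adj x y then creation (orb x σ) * annihilation (orb y σ) else 0) =
      if G.Adj x y then ((ε y : ℤ) : ℂ) • (if σ = 0 then creation (orb x 0) * creation (orb y 1)
        else -(creation (orb x 1) * creation (orb y 0))) else 0 := by
    intro x y σ
    by_cases hxy : G.Adj x y
    · simp only [if_pos hxy]
      exact hopTerm_commutator_etaRaise ε x y σ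
    · simp only [if_neg hxy, zero_mul, mul_zero, sub_zero]
  set S : Matrix (Finset (Orb Λ)) (Finset (Orb Λ)) ℂ :=
    ∑ x, ∑ y, (if G.Adj x y then ((ε y : ℤ) : ℂ) • K x y else 0) with hS
  have hcomm : (∑ x, ∑ y, ∑ σ : Fin 2,
        if G.Adj x y then creation (orb x σ) * annihilation (orb y σ) else 0) * etaRaise ε -
      etaRaise ε * (∑ x, ∑ y, ∑ σ : Fin 2,
        if G.Adj x y then creation (orb x σ) * annihilation (orb y σ) else 0) = S := by
    simp only [sum_mul, mul_sum, ← sum_sub_distrib, hterm]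
    refine sum_congr rfl fun x _ => sum_congr rfl fun y _ => ?_
    rw [Fin.sum_univ_two]
    by_cases hxy : G.Adj x y
    · rw [if_pos hxy, if_pos hxy, if_pos hxy, if_pos rfl, if_neg (by decide), ← smul_add]
      simp only [hK, sub_eq_add_neg]
    · rw [if_neg hxy, if_neg hxy, if_neg hxy, add_zero]
  have hneg : S = -S := by
    conv_rhs => rw [hS, sum_comm]
    rw [hS, ← sum_neg_distrib]
    refine sum_congr rfl fun x _ => ?_
    rw [← sum_neg_distrib]
    refine sum_congr rfl fun y _ => ?_
    by_cases h : G.Adj x y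
    · rw [if_pos h, if_pos h.symm, hKsymm, hε x y h, Units.val_neg, Int.cast_neg, neg_smul, neg_neg]
    · rw [if_neg h, if_neg (fun h' => h h'.symm), neg_zero]
  have h2 : (2 : ℂ) • S = 0 := by
    rw [two_smul]
    nth_rewrite 2 [hneg]
    exact add_neg_cancel S
  rw [← sub_eq_zero, hcomm]
  exact (smul_eq_zero.1 h2).resolve_left two_ne_zero

/-- Commutator of the on-site pair number `n_{x↑} n_{x↓}` with the pair creator at `z`:
`[n_{x↑} n_{x↓}, c†_{z↑} c†_{z↓}] = δ_xz c†_{z↑} c†_{z↓}`. Essler et al. (2005) §2.1,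
eqs. (2.8)–(2.11). [folklore] -/
theorem pairNumber_commutator_pairCreation (x z : Λ) :
    numberOp x 0 * numberOp x 1 * (creation (orb z 0) * creation (orb z 1)) -
        creation (orb z 0) * creation (orb z 1) * (numberOp x 0 * numberOp x 1) =
      if x = z then creation (orb z 0) * creation (orb z 1) else 0 := by
  simp only [numberOp]
  split_ifs with h
  · subst h
    have e1 : creation (orb x 1) * annihilation (orb x 1) * creation (orb x 0) =
        creation (orb x 0) * (creation (orb x 1) * annihilation (orb x 1)) :=
      number_mul_creation_of_ne (by simp)
    have e2 : creation (orb x 0) * annihilation (orb x 0) * creation (orb x 1) =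
        creation (orb x 1) * (creation (orb x 0) * annihilation (orb x 0)) :=
      number_mul_creation_of_ne (by simp)
    calc creation (orb x 0) * annihilation (orb x 0) * (creation (orb x 1) * annihilation (orb x 1)) *
            (creation (orb x 0) * creation (orb x 1)) -
          creation (orb x 0) * creation (orb x 1) *
            (creation (orb x 0) * annihilation (orb x 0) * (creation (orb x 1) * annihilation (orb x 1)))
        = creation (orb x 0) * annihilation (orb x 0) *
            (creation (orb x 1) * annihilation (orb x 1) * creation (orb x 0)) * creation (orb x 1) -
          creation (orb x 0) * (creation (orb x 1) * (creation (orb x 0) * annihilation (orb x 0))) *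
            (creation (orb x 1) * annihilation (orb x 1)) := by
          simp only [mul_assoc]
      _ = creation (orb x 0) * annihilation (orb x 0) *
            (creation (orb x 0) * (creation (orb x 1) * annihilation (orb x 1))) * creation (orb x 1) -
          creation (orb x 0) * (creation (orb x 0) * annihilation (orb x 0) * creation (orb x 1)) *
            (creation (orb x 1) * annihilation (orb x 1)) := by rw [e1, ← e2]
      _ = (creation (orb x 0) * annihilation (orb x 0) * creation (orb x 0)) *
            (creation (orb x 1) * annihilation (orb x 1) * creation (orb x 1)) -
          creation (orb x 0) * (creation (orb x 0) * annihilation (orb x 0)) * creation (orb x 1) *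
            (creation (orb x 1) * annihilation (orb x 1)) := by
          simp only [mul_assoc]
      _ = creation (orb x 0) * creation (orb x 1) := by
          rw [number_mul_creation_self, number_mul_creation_self, creation_mul_number_self, zero_mul,
            zero_mul, sub_zero]
  · have hc : ∀ σ τ : Fin 2, Commute (creation (orb x σ) * annihilation (orb x σ)) (creation (orb z τ)) :=
      fun σ τ => number_mul_creation_of_ne (by simp [h])
    rw [(((hc 0 0).mul_right (hc 0 1)).mul_left ((hc 1 0).mul_right (hc 1 1))).eq, sub_self]

/-- **The interaction term shifts `η†` by one pair**: `[Σ_x n_{x↑} n_{x↓}, η†_ε] = η†_ε` (each pair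
creator raises the number of doubly occupied sites by one). Yang, PRL 63 (1989) 2144, eq. (6);
Essler et al. (2005) §2.2.5. [cite: Yang1989, eq. (6)] -/
theorem interaction_commutator_etaRaise (ε : Λ → ℤˣ) :
    (∑ x, numberOp x 0 * numberOp x 1) * etaRaise ε - etaRaise ε * ∑ x, numberOp x 0 * numberOp x 1 =
      etaRaise ε := by
  rw [commutator_etaRaise]
  conv_rhs => rw [etaRaise]
  refine sum_congr rfl fun z _ => ?_
  rw [sum_mul, mul_sum, ← sum_sub_distrib]
  simp only [pairNumber_commutator_pairCreation, sum_ite_eq', mem_univ, if_true]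

/-- **Yang's commutator** `[H(t, U), η†_ε] = U η†_ε` for the Hubbard Hamiltonian on any finite
graph `G` and any sign `ε` that is bipartite for `G` (`ε_x = -ε_y` on edges): the hopping part
commutes with `η†` (`hopping_commute_etaRaise`) and the interaction contributes `U η†`
(`interaction_commutator_etaRaise`). Yang, PRL 63 (1989) 2144, eq. (6) (with Yang's `2W = U`);
Essler et al. (2005) §2.2.5, eqs. (2.84), (2.87). [cite: Yang1989, eq. (6)] -/
theorem hamiltonian_commutator_etaRaise (G : SimpleGraph Λ) [DecidableRel G.Adj] (ε : Λ → ℤˣ)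
    (hε : ∀ x y, G.Adj x y → ε x = -ε y) (t U : ℝ) :
    hamiltonian G t U * etaRaise ε - etaRaise ε * hamiltonian G t U = (U : ℂ) • etaRaise ε := by
  have hT := hopping_commute_etaRaise G ε hε
  have hV : (∑ x, numberOp x 0 * numberOp x 1) * etaRaise ε =
      etaRaise ε + etaRaise ε * ∑ x, numberOp x 0 * numberOp x 1 :=
    sub_eq_iff_eq_add.1 (interaction_commutator_etaRaise ε)
  simp only [hamiltonian, add_mul, mul_add, smul_mul_assoc, mul_smul_comm, hT, hV, smul_add]
  abel

/-- **`[N, η†] = 2 η†` for a single pair creator**: `[N, c†_p c†_q] = 2 c†_p c†_q` for the total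
particle number `N = Σ_i n_i`. Essler et al. (2005) §2.2.5, eq. (2.87). [folklore] -/
theorem totalNumber_commutator_pairCreation (p q : Orb Λ) :
    totalNumber * (creation p * creation q) - creation p * creation q * totalNumber =
      (2 : ℂ) • (creation p * creation q) := by
  rw [← totalNumberOp_eq_totalNumber]
  simp only [totalNumberOp, numberAt, sum_mul, mul_sum, ← sum_sub_distrib, number_pair_commutator,
    sum_add_distrib, sum_ite_eq', mem_univ, if_true, two_smul]

/-- **Discharge of `totalNumber_commutator_etaRaise`**: `η†` raises the particle number by two,
`[N, η†_ε] = 2 η†_ε`, for every sign `ε`. Essler et al. (2005) §2.2.5, eq. (2.87); Yang, PRL 63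
(1989) 2144. [cite: EsslerEtAl2005, §2.2.5 eq. (2.87)] -/
theorem totalNumber_commutator_etaRaise_holds : totalNumber_commutator_etaRaise (Λ := Λ) := by
  intro ε
  rw [commutator_etaRaise, etaRaise, smul_sum]
  refine sum_congr rfl fun z _ => ?_
  rw [totalNumber_commutator_pairCreation, smul_comm]

/-- The Hubbard Hamiltonian annihilates the vacuum, `H(t, U) |0⟩ = 0` (every term ends in an
annihilation operator). Essler et al. (2005) §2.1, eqs. (2.3), (2.8). [folklore] -/
theorem hamiltonian_mulVec_vacuum (G : SimpleGraph Λ) [DecidableRel G.Adj] (t U : ℝ) :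
    hamiltonian G t U *ᵥ (vacuum : Fock (Orb Λ)) = 0 := by
  have han : ∀ (A : Matrix (Finset (Orb Λ)) (Finset (Orb Λ)) ℂ) (i : Orb Λ),
      (A * annihilation i) *ᵥ (vacuum : Fock (Orb Λ)) = 0 := fun A i => by
    rw [← mulVec_mulVec, annihilation_mulVec_vacuum_holds, mulVec_zero]
  have hT : ∀ x y (σ : Fin 2), (if G.Adj x y then creation (orb x σ) * annihilation (orb y σ) else 0) *ᵥ
      (vacuum : Fock (Orb Λ)) = 0 := by
    intro x y σ
    split_ifs
    · exact han _ _
    · exact zero_mulVec _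
  simp only [hamiltonian, add_mulVec, smul_mulVec, sum_mulVec, hT, numberOp, sum_const_zero, smul_zero,
    zero_add]
  simp only [← mul_assoc, han, sum_const_zero, smul_zero]

/-! ### Explicit form of the `η`-tower on the vacuum -/

/-- **Pair creators act on fully paired basis states without sign.** If `P S ⊆ Orb Λ` is the set of
both orbitals over the sites of `S` (`i ∈ P S ↔ site(i) ∈ S`), then
`c†_{x↑} c†_{x↓} |P S⟩ = |P (S ∪ {x})⟩` for `x ∉ S` and `= 0` for `x ∈ S`: the two Jordan–Wigner
signs coincide because `(x,↑) < (x,↓)` are adjacent in the lexicographic order and every orbital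
of `P S` below `(x,↓)` is already below `(x,↑)`. Essler et al. (2005) §2.1, eqs. (2.4)–(2.7)
(Wannier states, the doubly occupied site `c†_{j↑} c†_{j↓} |0⟩`). [folklore] -/
theorem pairCreation_mulVec_single_pairs {P : Finset Λ → Finset (Orb Λ)}
    (hP : ∀ S i, i ∈ P S ↔ (ofLex i).1 ∈ S) (x : Λ) (S : Finset Λ) :
    (creation (orb x 0) * creation (orb x 1)) *ᵥ Pi.single (P S) (1 : ℂ) =
      if x ∈ S then 0 else Pi.single (P (insert x S)) 1 := by
  rw [← mulVec_mulVec, FermionOperators.creation_mulVec_single]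
  have h1 : orb x 1 ∈ P S ↔ x ∈ S := by rw [hP]; simp
  by_cases hx : x ∈ S
  · rw [if_pos (h1.2 hx), mulVec_zero, if_pos hx]
  · have h0 : orb x 0 ∉ insert (orb x 1) (P S) := by
      simp [mem_insert, hP, hx]
    rw [if_neg (mt h1.1 hx), mulVec_smul, FermionOperators.creation_mulVec_single, if_neg h0, smul_smul, if_neg hx]
    have hset : insert (orb x 0) (insert (orb x 1) (P S)) = P (insert x S) := by
      ext i
      simp only [mem_insert, hP]
      constructor
      · rintro (rfl | rfl | h)
        · simp
        · simp
        · exact Or.inr h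
      · rintro (h | h)
        · have hi : i = orb (ofLex i).1 (ofLex i).2 := by simp [orb]
          rcases Fin.exists_fin_two.1 ⟨(ofLex i).2, rfl⟩ with h2 | h2
          · left; rw [hi, h, h2]
          · right; left; rw [hi, h, h2]
        · exact Or.inr (Or.inr h)
    have hlt : ¬orb x 1 < orb x 0 := by simp [orb, Prod.Lex.toLex_lt_toLex]
    have hfilter : (P S).filter (· < orb x 1) = (P S).filter (· < orb x 0) := by
      refine filter_congr fun i hi => ?_
      have hne : (ofLex i).1 ≠ x := fun h => hx (h ▸ (hP S i).1 hi)
      simp [orb, Prod.Lex.lt_iff, hne]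
    have hsign : jwSign (orb x 1) (P S) * jwSign (orb x 0) (insert (orb x 1) (P S)) = 1 := by
      rw [jwSign_insert_of_not_lt hlt, jwSign, hfilter, ← jwSign, jwSign_mul_self]
    rw [hset, hsign, one_smul]

/-- `η†_ε` on a fully paired basis state: `η† |P S⟩ = Σ_{x ∉ S} ε_x |P (S ∪ {x})⟩`.
Yang, PRL 63 (1989) 2144, eqs. (4), (7). [folklore] -/
theorem etaRaise_mulVec_single_pairs {P : Finset Λ → Finset (Orb Λ)}
    (hP : ∀ S i, i ∈ P S ↔ (ofLex i).1 ∈ S) (ε : Λ → ℤˣ) (S : Finset Λ) :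
    etaRaise ε *ᵥ Pi.single (P S) (1 : ℂ) =
      ∑ x, if x ∈ S then 0 else ((ε x : ℤ) : ℂ) • Pi.single (P (insert x S)) 1 := by
  rw [etaRaise, sum_mulVec]
  refine sum_congr rfl fun x _ => ?_
  rw [smul_mulVec, pairCreation_mulVec_single_pairs hP]
  split_ifs <;> simp

/-- Double counting of (`m`-subset, outside point) versus (`(m+1)`-subset, inside point):
`Σ_{#S = m} Σ_{x ∈ s ∖ S} f(S ∪ {x}) = (m + 1) • Σ_{#T = m+1} f(T)` (each `T` arises from its
`m + 1` points). [folklore] -/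
theorem sum_powersetCard_sum_insert {α β : Type*} [DecidableEq α] [AddCommMonoid β] (s : Finset α)
    (m : ℕ) (f : Finset α → β) :
    ∑ S ∈ powersetCard m s, ∑ x ∈ s \ S, f (insert x S) =
      (m + 1) • ∑ T ∈ powersetCard (m + 1) s, f T := by
  calc ∑ S ∈ powersetCard m s, ∑ x ∈ s \ S, f (insert x S)
      = ∑ p ∈ (powersetCard m s).sigma (fun S => s \ S), f (insert p.2 p.1) :=
        (sum_sigma _ _ fun p : (Σ _ : Finset α, α) => f (insert p.2 p.1)).symm
    _ = ∑ p ∈ (powersetCard (m + 1) s).sigma (fun T => T), f p.1 := by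
        refine sum_nbij' (fun p : (Σ _ : Finset α, α) => (⟨insert p.2 p.1, p.2⟩ : Σ _ : Finset α, α))
          (fun p : (Σ _ : Finset α, α) => (⟨p.1.erase p.2, p.2⟩ : Σ _ : Finset α, α)) ?_ ?_ ?_ ?_ ?_
        · rintro ⟨S, x⟩ h
          simp only [mem_sigma, mem_powersetCard, mem_sdiff] at h ⊢
          exact ⟨⟨insert_subset h.2.1 h.1.1, by rw [card_insert_of_notMem h.2.2, h.1.2]⟩,
            mem_insert_self x S⟩
        · rintro ⟨T, x⟩ h
          simp only [mem_sigma, mem_powersetCard, mem_sdiff] at h ⊢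
          exact ⟨⟨(erase_subset x T).trans h.1.1, by rw [card_erase_of_mem h.2, h.1.2]; rfl⟩,
            h.1.1 h.2, notMem_erase x T⟩
        · rintro ⟨S, x⟩ h
          simp only [mem_sigma, mem_powersetCard, mem_sdiff] at h
          simp [erase_insert h.2.2]
        · rintro ⟨T, x⟩ h
          simp only [mem_sigma, mem_powersetCard] at h
          simp [insert_erase h.2]
        · intro p _; rfl
    _ = ∑ T ∈ powersetCard (m + 1) s, ∑ x ∈ T, f T := sum_sigma _ _ _
    _ = ∑ T ∈ powersetCard (m + 1) s, (m + 1) • f T :=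
        sum_congr rfl fun T hT => by rw [sum_const, (mem_powersetCard.1 hT).2]
    _ = (m + 1) • ∑ T ∈ powersetCard (m + 1) s, f T := smul_sum.symm

/-- **Explicit form of the `η`-tower** (`P` as in `pairCreation_mulVec_single_pairs`):
`(η†_ε)^m |0⟩ = m! · Σ_{S ⊆ Λ, #S = m} (∏_{x ∈ S} ε_x) |P S⟩`, i.e. `m!` times the signed sum of
all configurations of `m` doubly occupied sites. Yang, PRL 63 (1989) 2144, eq. (7) and the
counting below eq. (9); Essler et al. (2005) §2.2.5. [cite: Yang1989, eq. (7)] -/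
theorem etaRaise_pow_mulVec_vacuum {P : Finset Λ → Finset (Orb Λ)}
    (hP : ∀ S i, i ∈ P S ↔ (ofLex i).1 ∈ S) (ε : Λ → ℤˣ) (m : ℕ) :
    etaRaise ε ^ m *ᵥ (vacuum : Fock (Orb Λ)) =
      (m.factorial : ℂ) • ∑ S ∈ powersetCard m univ,
        (∏ x ∈ S, ((ε x : ℤ) : ℂ)) • Pi.single (P S) 1 := by
  induction m with
  | zero =>
    have hP0 : P ∅ = ∅ := by ext i; simp [hP]
    rw [pow_zero, one_mulVec, Nat.factorial_zero, Nat.cast_one, one_smul, powersetCard_zero,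
      sum_singleton, prod_empty, one_smul, hP0]
    rfl
  | succ m ih =>
    have hstep : ∀ S : Finset Λ, etaRaise ε *ᵥ ((∏ x ∈ S, ((ε x : ℤ) : ℂ)) • Pi.single (P S) (1 : ℂ)) =
        ∑ x ∈ univ \ S, (∏ y ∈ insert x S, ((ε y : ℤ) : ℂ)) • Pi.single (P (insert x S)) 1 := by
      intro S
      rw [mulVec_smul, etaRaise_mulVec_single_pairs hP, smul_sum]
      have hfilt : univ \ S = univ.filter (· ∉ S) := by ext; simp
      rw [hfilt, sum_filter]
      refine sum_congr rfl fun x _ => ?_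
      by_cases hx : x ∈ S
      · simp [hx]
      · rw [if_neg hx, if_pos hx, smul_smul, prod_insert hx, mul_comm]
    have hcount := sum_powersetCard_sum_insert (univ : Finset Λ) m
      (fun T => (∏ y ∈ T, ((ε y : ℤ) : ℂ)) • Pi.single (P T) (1 : ℂ))
    beta_reduce at hcount
    rw [pow_succ', ← mulVec_mulVec, ih, mulVec_smul, mulVec_sum]
    simp only [hstep]
    rw [hcount, Nat.factorial_succ, Nat.cast_mul, mul_smul, ← Nat.cast_smul_eq_nsmul ℂ]
    exact smul_comm _ _ _

/-- **The `η`-tower does not terminate before `|Λ|` pairs**: `(η†_ε)^m |0⟩ ≠ 0` for `m ≤ |Λ|`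
(the coefficient of `|P S₀⟩`, `#S₀ = m`, is `m! ∏_{x ∈ S₀} ε_x ≠ 0`). Yang, PRL 63 (1989) 2144,
eq. (7) (`N ≤ M` there, `N = 2m`); Essler et al. (2005) §2.2.5 and eq. (3.101)–(3.102)
(`η`-multiplets of dimension `L - N + 1`). [cite: Yang1989, eq. (7)] -/
theorem etaRaise_pow_mulVec_vacuum_ne_zero (ε : Λ → ℤˣ) {m : ℕ} (hm : m ≤ Fintype.card Λ) :
    etaRaise ε ^ m *ᵥ (vacuum : Fock (Orb Λ)) ≠ 0 := by
  obtain ⟨P, hP⟩ : ∃ P : Finset Λ → Finset (Orb Λ), ∀ S i, i ∈ P S ↔ (ofLex i).1 ∈ S :=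
    ⟨fun S => (S ×ˢ univ).map (Equiv.toEmbedding toLex), fun S i => by simp [mem_map_equiv]⟩
  have hinj : ∀ S T, P S = P T → S = T := fun S T h => by
    ext x
    have h1 := hP S (orb x 0)
    have h2 := hP T (orb x 0)
    rw [h] at h1
    simp only [orb, ofLex_toLex] at h1 h2
    rw [← h1, ← h2]
  obtain ⟨S₀, hS₀⟩ := powersetCard_nonempty.2 (show m ≤ (univ : Finset Λ).card by rwa [card_univ])
  intro h0
  have h := congrFun (etaRaise_pow_mulVec_vacuum hP ε m) (P S₀)
  rw [h0, Pi.zero_apply, Pi.smul_apply, Finset.sum_apply, sum_eq_single S₀, Pi.smul_apply,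
    Pi.single_eq_same, smul_eq_mul, smul_eq_mul, mul_one] at h
  · refine mul_ne_zero (Nat.cast_ne_zero.2 (Nat.factorial_ne_zero m)) ?_ h.symm
    exact prod_ne_zero_iff.2 fun x _ => Int.cast_ne_zero.2 (Units.ne_zero (ε x))
  · intro S _ hne
    rw [Pi.smul_apply, Pi.single_eq_of_ne (fun h' => hne (hinj _ _ h').symm), smul_zero]
  · exact fun h' => absurd hS₀ h'

/-- The `η`-tower has `2m` particles: `(η†_ε)^m |0⟩` is supported on occupation sets of
cardinality `2m`. Yang, PRL 63 (1989) 2144, eq. (7); Essler et al. (2005) eq. (2.87).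
[folklore] -/
theorem isNParticle_etaRaise_pow_mulVec_vacuum (ε : Λ → ℤˣ) (m : ℕ) :
    IsNParticle (2 * m) (etaRaise ε ^ m *ᵥ (vacuum : Fock (Orb Λ))) := by
  set P : Finset Λ → Finset (Orb Λ) := fun S => (S ×ˢ univ).map (Equiv.toEmbedding toLex) with hPdef
  have hP : ∀ S i, i ∈ P S ↔ (ofLex i).1 ∈ S := fun S i => by simp [hPdef, mem_map_equiv]
  have hcard : ∀ S, (P S).card = 2 * S.card := fun S => by
    rw [hPdef, card_map, card_product, card_univ, Fintype.card_fin, mul_comm]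
  intro s hs
  rw [etaRaise_pow_mulVec_vacuum hP, Pi.smul_apply, Finset.sum_apply, sum_eq_zero, smul_zero]
  intro S hS
  rw [Pi.smul_apply, Pi.single_eq_of_ne, smul_zero]
  rintro rfl
  exact hs (by rw [hcard, (mem_powersetCard.1 hS).2])

end Hubbard

end Literature.MathematicalPhysics.QuantumLattice

/-! ### Grading: `c_i` lowers the particle number by one (appended discharge) -/

namespace Literature.MathematicalPhysics.QuantumLattice

open Matrix Finset

variable {ι : Type*} [LinearOrder ι] [Fintype ι]

/-- **Discharge of `Literature.MathematicalPhysics.QuantumLattice.IsNParticle.annihilation_mulVec`**: `c_i` maps the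
`(N+1)`-particle sector into the `N`-particle sector. In the occupation basis
`(c_i ψ)(s) = Σ_t ⟨s| c_i |t⟩ ψ(t)` with `⟨s| c_i |t⟩ = [i ∉ s ∧ t = insert i s] σ_i(s)`, so only
`t = insert i s` with `i ∉ s`, i.e. `#t = #s + 1`, contributes; for an `(N+1)`-particle `ψ` this
forces `#s = N`, so `c_i ψ` is supported on `#s = N`. This is the grading `a(f) 𝔥ⁿ⁺¹ ⊆ 𝔥ⁿ` of the
annihilation operator on the antisymmetric Fock space, Bratteli–Robinson II §5.2.1–§5.2.2
(companion of `IsNParticle.creation_mulVec_holds` above). [cite: BratteliRobinsonII1997, §5.2.2] -/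
theorem IsNParticle.annihilation_mulVec_holds : IsNParticle.annihilation_mulVec (ι := ι) := by
  intro N ψ hψ i s hs
  simp only [mulVec, dotProduct, annihilation]
  refine sum_eq_zero fun t _ => ?_
  split_ifs with h
  · have ht : t.card ≠ N + 1 := fun htN => hs (by
      have hc := card_insert_of_notMem h.1
      rw [← h.2, htN] at hc
      omega)
    rw [hψ t ht, mul_zero]
  · rw [zero_mul]

end Literature.MathematicalPhysics.QuantumLattice
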